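import Summits.Schanuel.Schanuel.Theorems.RootDecomp1KRelLiouvilleCell07

/-!
# RootDecomp1KRelLiouvilleCell — lens 1, generation 34 «RELATIVE-LIOUVILLE CELL of 33364» (RootDecomp1KRelLiouvilleCell.lean fc1db392…, 1985 l) — continuation (RootDecomp1KRelLiouvilleCell08): §8 the relative-Liouville CELLS against item 33364 (`finiteOrderLiouvilleSchanuel_relLiouvilleCell` mod `hNW`, `…_relLiouvilleCell_pi` hypothesis-free) and the explicit members `z_R = (1, ℓ₂, ℓ_T)`, `z_R^π` (`linearIndependent_zR`, `linLiouville_zR`, `not_hyperLinLiouville_zR`, `sb_zR`, `sb_zRpi`)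

(lens-1 g34 `RootDecomp1KRelLiouvilleCell.lean`, sha256 fc1db392…9176, own farm rc 0 · 0 sorry · axioms std; critic VERDICT STATUS L1658 PORT GO LOW;
port by census-1 gen 15 in eight parts `RootDecomp1KRelLiouvilleCell01`–`08` — see the PORT NOTE of part 01; `--supports stmt-Schanuel-33364`; rung 0.)
-/

noncomputable section

open Complex IntermediateField Polynomial
open Summit.Schanuel.Schanuel.Theorems.RootDecomp1KHyper
open Summit.Schanuel.Schanuel.Theorems.RootDecomp1KHyper.HyperCell
open Summit.Schanuel.Schanuel.Theorems.RootDecomp1KGeneric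

namespace Summit.Schanuel.Schanuel.Theorems.RootDecomp1KRelLiouvilleCell

/-! ## §8  The relative-Liouville cell against item 33364, and the explicit member `z_R = (1, ℓ₂, ℓ_T)` -/

section Cells
open LiouvilleNumber
open scoped Nat

/-- **Schanuel's bound on the relative-Liouville cell, e-version** (mod the Nesterenko–Waldschmidt measure
of `e`, `hNW : NWMeasure` = verbatim `Literature.NumberTheory.Transcendental.NesterenkoWaldschmidt1996_thm_4_2`,
which the tree PROVES — `NesterenkoWaldschmidt1996_thm_4_2_holds` — discharge by name when that cone is built):
for every log-hyper-Liouville real `ρ`, `trdeg ℚ(1, ℓ₂, ρ, e, e^{ℓ₂}, e^ρ) ≥ 3`. -/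
theorem sb_relLiouvilleCell (hNW : NWMeasure) {ρ : ℝ} (hρ : LogHyperLiouville ρ) :
    SB 3 ![(1 : ℂ), ((liouvilleNumber 2 : ℝ) : ℂ), (ρ : ℂ)] := by
  refine sb_of_logHyperLiouville_of_logPowMeasure (n := 2) hρ ?_
    (logPowMeasure_liouvilleNumber_exp_one hNW) ?_
  · exact subset_adjoin ℚ _ (Or.inl (Or.inl ⟨2, rfl⟩))
  · refine Fin.forall_fin_two.mpr ⟨?_, ?_⟩
    · exact subset_adjoin ℚ _ (Or.inl (Or.inl ⟨1, rfl⟩))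
    · exact subset_adjoin ℚ _ (Or.inl (Or.inr ⟨0, rfl⟩))

/-- **Schanuel's bound on the relative-Liouville cell, π-version — HYPOTHESIS-FREE** (the measure of `π`
is tree-proved, `polyMeasure_pi`): for every log-hyper-Liouville real `ρ`,
`trdeg ℚ(π, πℓ₂, πρ, e^π, e^{πℓ₂}, e^{πρ}) ≥ 3`. -/
theorem sb_relLiouvilleCell_pi {ρ : ℝ} (hρ : LogHyperLiouville ρ) :
    SB 3 ![(Real.pi : ℂ), (Real.pi : ℂ) * ((liouvilleNumber 2 : ℝ) : ℂ), (Real.pi : ℂ) * (ρ : ℂ)] := by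
  set z : Fin 3 → ℂ :=
    ![(Real.pi : ℂ), (Real.pi : ℂ) * ((liouvilleNumber 2 : ℝ) : ℂ), (Real.pi : ℂ) * (ρ : ℂ)] with hz
  have hπ0 : (Real.pi : ℂ) ≠ 0 := by exact_mod_cast Real.pi_ne_zero
  have hz0 : z 0 ∈ adjoin ℚ (SFset z ∪ {I}) := subset_adjoin ℚ _ (Or.inl (Or.inl ⟨0, rfl⟩))
  have hz1 : z 1 ∈ adjoin ℚ (SFset z ∪ {I}) := subset_adjoin ℚ _ (Or.inl (Or.inl ⟨1, rfl⟩))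
  have hz2 : z 2 ∈ adjoin ℚ (SFset z ∪ {I}) := subset_adjoin ℚ _ (Or.inl (Or.inl ⟨2, rfl⟩))
  have ez0 : z 0 = (Real.pi : ℂ) := rfl
  have ez1 : z 1 = (Real.pi : ℂ) * ((liouvilleNumber 2 : ℝ) : ℂ) := rfl
  have ez2 : z 2 = (Real.pi : ℂ) * (ρ : ℂ) := rfl
  have eρ : (ρ : ℂ) = z 2 / z 0 := by rw [ez2, ez0, mul_div_cancel_left₀ _ hπ0]
  have eℓ : ((liouvilleNumber 2 : ℝ) : ℂ) = z 1 / z 0 := by rw [ez1, ez0, mul_div_cancel_left₀ _ hπ0]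
  refine sb_of_logHyperLiouville_of_logPowMeasure (n := 2) hρ ?_ logPowMeasure_liouvilleNumber_pi ?_
  · rw [eρ]; exact div_mem hz2 hz0
  · refine Fin.forall_fin_two.mpr ⟨?_, ?_⟩
    · show ((liouvilleNumber 2 : ℝ) : ℂ) ∈ _
      rw [eℓ]; exact div_mem hz1 hz0
    · exact hz0

/-- Cardinal bookkeeping: a tuple `z : Fin n → ℂ` whose range is the range of a `Fin N`-tuple, with `z`
injective, has `n ≤ N`, and the Schanuel field only sees `Set.range z`. -/
private theorem sb_of_range_eq {n N : ℕ} {z : Fin n → ℂ} {w : Fin N → ℂ} (hz : Function.Injective z)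
    (hrange : Set.range z = Set.range w) (hw : SB N w) :
    (n : Cardinal) ≤ Algebra.trdeg ℚ
      ↥(IntermediateField.adjoin ℚ (Set.range z ∪ Set.range (Complex.exp ∘ z))) := by
  have e : Set.range z ∪ Set.range (Complex.exp ∘ z) = Set.range w ∪ Set.range (Complex.exp ∘ w) := by
    rw [Set.range_comp, Set.range_comp, hrange]
  have hnN : (n : Cardinal) ≤ (N : Cardinal) :=
    calc (n : Cardinal) = Cardinal.mk (Fin n) := (Cardinal.mk_fin n).symm
      _ = Cardinal.mk (Set.range z) := (Cardinal.mk_range_eq z hz).symm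
      _ = Cardinal.mk (Set.range w) := by rw [hrange]
      _ ≤ Cardinal.mk (Fin N) := Cardinal.mk_range_le
      _ = N := Cardinal.mk_fin N
  rw [e]
  exact hnN.trans hw

/-- **ITEM 33364 ON THE RELATIVE-LIOUVILLE CELL (e-version, mod `hNW`).** Binders of
`Summit.Schanuel.Schanuel.Theses.RootDecomp1K.FiniteOrderLiouvilleSchanuel` VERBATIM, with ONE line inserted
after `LinearIndependent ℚ z` — the cell `Set.range z = Set.range (1, ℓ₂, ρ)`, `ρ` ranging over the
LOG-HYPER-LIOUVILLE reals (outer parameters `ρ`, `hρ`). The two Diophantine hypotheses are not used by the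
proof (the conclusion holds outright on the cell); they are CERTIFIED at the member `z_R` below. -/
theorem finiteOrderLiouvilleSchanuel_relLiouvilleCell (hNW : NWMeasure) {ρ : ℝ}
    (hρ : LogHyperLiouville ρ) :
    ∀ (n : ℕ) (z : Fin n → ℂ), LinearIndependent ℚ z →
      Set.range z = Set.range ![(1 : ℂ), ((liouvilleNumber 2 : ℝ) : ℂ), (ρ : ℂ)] →
      (∀ ω : ℕ, ∃ h : Fin n → ℤ, h ≠ 0 ∧ ‖∑ i, (h i : ℂ) * z i‖ < 1 / (1 + ∑ i, (|h i| : ℝ)) ^ ω) →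
      (¬ ∀ m : ℕ, ∃ h : Fin n → ℤ, h ≠ 0 ∧
        ‖∑ i, (h i : ℂ) * z i‖ < Real.exp (-((1 + ∑ i, (|h i| : ℝ)) ^ m))) →
      (n : Cardinal) ≤ Algebra.trdeg ℚ
        ↥(IntermediateField.adjoin ℚ (Set.range z ∪ Set.range (Complex.exp ∘ z))) := by
  intro n z hz hrange _ _
  exact sb_of_range_eq hz.injective hrange (sb_relLiouvilleCell hNW hρ)

/-- **ITEM 33364 ON THE RELATIVE-LIOUVILLE CELL, π-version — HYPOTHESIS-FREE.** Same binders verbatim, the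
cell line `Set.range z = Set.range (π, πℓ₂, πρ)`, `ρ` log-hyper-Liouville. -/
theorem finiteOrderLiouvilleSchanuel_relLiouvilleCell_pi {ρ : ℝ} (hρ : LogHyperLiouville ρ) :
    ∀ (n : ℕ) (z : Fin n → ℂ), LinearIndependent ℚ z →
      Set.range z = Set.range ![(Real.pi : ℂ), (Real.pi : ℂ) * ((liouvilleNumber 2 : ℝ) : ℂ),
        (Real.pi : ℂ) * (ρ : ℂ)] →
      (∀ ω : ℕ, ∃ h : Fin n → ℤ, h ≠ 0 ∧ ‖∑ i, (h i : ℂ) * z i‖ < 1 / (1 + ∑ i, (|h i| : ℝ)) ^ ω) →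
      (¬ ∀ m : ℕ, ∃ h : Fin n → ℤ, h ≠ 0 ∧
        ‖∑ i, (h i : ℂ) * z i‖ < Real.exp (-((1 + ∑ i, (|h i| : ℝ)) ^ m))) →
      (n : Cardinal) ≤ Algebra.trdeg ℚ
        ↥(IntermediateField.adjoin ℚ (Set.range z ∪ Set.range (Complex.exp ∘ z))) := by
  intro n z hz hrange _ _
  exact sb_of_range_eq hz.injective hrange (sb_relLiouvilleCell_pi hρ)

/-! ### The member `z_R = (1, ℓ₂, ℓ_T)` and its π-twin `z_R^π = (π, πℓ₂, πℓ_T)` -/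

/-- The relative-Liouville member `z_R := (1, ℓ₂, ℓ_T)`. -/
noncomputable def zR : Fin 3 → ℂ := ![(1 : ℂ), ((liouvilleNumber 2 : ℝ) : ℂ), ((ellT : ℝ) : ℂ)]

/-- Its π-twin `z_R^π := (π, πℓ₂, πℓ_T)`. -/
noncomputable def zRpi : Fin 3 → ℂ :=
  ![(Real.pi : ℂ), (Real.pi : ℂ) * ((liouvilleNumber 2 : ℝ) : ℂ), (Real.pi : ℂ) * ((ellT : ℝ) : ℂ)]

/-- An integer form in `z_R = (1, ℓ₂, ℓ_T)` is the real number `g₀ + g₁ ℓ₂ + g₂ ℓ_T`. -/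
theorem zR_form (g : Fin 3 → ℤ) :
    ∑ i, (g i : ℂ) * zR i = (((g 0 : ℝ) + g 1 * liouvilleNumber 2 + g 2 * ellT : ℝ) : ℂ) := by
  rw [Fin.sum_univ_three]
  simp only [zR, Matrix.cons_val_zero, Matrix.cons_val_one, Matrix.cons_val_two, Matrix.head_cons,
    Matrix.tail_cons]
  push_cast; ring

/-- An integer form in `z_R^π = (π, πℓ₂, πℓ_T)` is `π · (g₀ + g₁ ℓ₂ + g₂ ℓ_T)`. -/
theorem zRpi_form (g : Fin 3 → ℤ) :
    ∑ i, (g i : ℂ) * zRpi i =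
      (Real.pi : ℂ) * (((g 0 : ℝ) + g 1 * liouvilleNumber 2 + g 2 * ellT : ℝ) : ℂ) := by
  rw [Fin.sum_univ_three]
  simp only [zRpi, Matrix.cons_val_zero, Matrix.cons_val_one, Matrix.cons_val_two, Matrix.head_cons,
    Matrix.tail_cons]
  push_cast; ring

/-- The norm of an integer form in `z_R` is `|g₀ + g₁ ℓ₂ + g₂ ℓ_T|`. -/
theorem norm_zR_form (g : Fin 3 → ℤ) :
    ‖∑ i, (g i : ℂ) * zR i‖ = |(g 0 : ℝ) + g 1 * liouvilleNumber 2 + g 2 * ellT| := by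
  rw [zR_form, Complex.norm_real, Real.norm_eq_abs]

/-- The norm of an integer form in `z_R^π` is `π · |g₀ + g₁ ℓ₂ + g₂ ℓ_T|`. -/
theorem norm_zRpi_form (g : Fin 3 → ℤ) :
    ‖∑ i, (g i : ℂ) * zRpi i‖ = Real.pi * |(g 0 : ℝ) + g 1 * liouvilleNumber 2 + g 2 * ellT| := by
  rw [zRpi_form, norm_mul, Complex.norm_real, Complex.norm_real, Real.norm_eq_abs, Real.norm_eq_abs,
    abs_of_pos Real.pi_pos]

/-- No non-zero integer relation among `1, ℓ₂, ℓ_T`. -/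
theorem zR_form_ne_zero (g : Fin 3 → ℤ) (hg : g ≠ 0) :
    (g 0 : ℝ) + g 1 * liouvilleNumber 2 + g 2 * ellT ≠ 0 := by
  intro h0
  have := form_lower_bound g hg
  rw [h0, abs_zero] at this
  exact absurd this (not_le.mpr (Real.exp_pos _))

/-- From integer to rational relations (clearing denominators). -/
private theorem linearIndependent_of_int_forms {z : Fin 3 → ℂ}
    (hz : ∀ g : Fin 3 → ℤ, g ≠ 0 → ∑ i, (g i : ℂ) * z i ≠ 0) : LinearIndependent ℚ z := by
  rw [Fintype.linearIndependent_iff]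
  intro g hg
  by_contra hne
  obtain ⟨i₀, hi₀⟩ := not_forall.mp hne
  have hg' : ((g 0 : ℚ) : ℂ) * z 0 + ((g 1 : ℚ) : ℂ) * z 1 + ((g 2 : ℚ) : ℂ) * z 2 = 0 := by
    simpa [Rat.smul_def, Fin.sum_univ_three] using hg
  have e0 : ((g 0 : ℚ) : ℂ) * ((g 0).den : ℂ) = ((g 0).num : ℂ) := by
    exact_mod_cast Rat.mul_den_eq_num (g 0)
  have e1 : ((g 1 : ℚ) : ℂ) * ((g 1).den : ℂ) = ((g 1).num : ℂ) := by
    exact_mod_cast Rat.mul_den_eq_num (g 1)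
  have e2 : ((g 2 : ℚ) : ℂ) * ((g 2).den : ℂ) = ((g 2).num : ℂ) := by
    exact_mod_cast Rat.mul_den_eq_num (g 2)
  set H : Fin 3 → ℤ := ![(g 0).num * ((g 1).den * (g 2).den : ℕ),
    (g 1).num * ((g 0).den * (g 2).den : ℕ), (g 2).num * ((g 0).den * (g 1).den : ℕ)] with hH
  have hd0 := (g 0).den_pos
  have hd1 := (g 1).den_pos
  have hd2 := (g 2).den_pos
  have hH0 : H ≠ 0 := by
    intro hzero
    have hnum : (g i₀).num ≠ 0 := Rat.num_ne_zero.mpr hi₀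
    have hc := congr_fun hzero i₀
    fin_cases i₀
    all_goals
      simp only [hH, Pi.zero_apply] at hc
      exact mul_ne_zero hnum (by positivity) hc
  have hrel : ∑ i, (H i : ℂ) * z i = 0 := by
    rw [Fin.sum_univ_three]
    simp only [hH, Matrix.cons_val_zero, Matrix.cons_val_one, Matrix.cons_val_two, Matrix.head_cons,
      Matrix.tail_cons]
    push_cast
    linear_combination (-(((g 1).den : ℂ) * ((g 2).den : ℂ) * z 0)) * e0
      - (((g 0).den : ℂ) * ((g 2).den : ℂ) * z 1) * e1
      - (((g 0).den : ℂ) * ((g 1).den : ℂ) * z 2) * e2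
      + (((g 0).den : ℂ) * ((g 1).den : ℂ) * ((g 2).den : ℂ)) * hg'
  exact hz H hH0 hrel

/-- **(i) `z_R` is ℚ-linearly independent** (hypothesis-free). -/
theorem linearIndependent_zR : LinearIndependent ℚ zR := by
  refine linearIndependent_of_int_forms fun g hg hrel => ?_
  have h := zR_form g
  rw [hrel] at h
  exact zR_form_ne_zero g hg (by exact_mod_cast h.symm)

/-- **(i^π) `z_R^π` is ℚ-linearly independent** (hypothesis-free). -/
theorem linearIndependent_zRpi : LinearIndependent ℚ zRpi := by
  refine linearIndependent_of_int_forms fun g hg hrel => ?_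
  have h := zRpi_form g
  rw [hrel] at h
  have hπ0 : (Real.pi : ℂ) ≠ 0 := by exact_mod_cast Real.pi_ne_zero
  have h' := (mul_eq_zero.mp h.symm).resolve_left hπ0
  exact zR_form_ne_zero g hg (by exact_mod_cast h')

/-- **(ii) `z_R` is Liouville to every polynomial order** (through its prefix `(1, ℓ₂)`; hypothesis-free). -/
theorem linLiouville_zR : LinLiouville zR := by
  have hℓ : Liouville (liouvilleNumber 2) := by
    simpa using liouville_liouvilleNumber (le_refl 2)
  refine linLiouville_of_prefix (k := 2) (n := 3) (by norm_num) ?_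
  have h2 : (fun i : Fin 2 => zR (Fin.castLE (show 2 ≤ 3 by norm_num) i)) =
      ![(1 : ℂ), ((liouvilleNumber 2 : ℝ) : ℂ) * 1] := by
    funext i; fin_cases i <;> simp [zR]
  rw [h2]
  exact linLiouville_of_liouville_ratio hℓ 1

/-- **(ii^π) `z_R^π` is Liouville to every polynomial order** (prefix `(π, πℓ₂)`; hypothesis-free). -/
theorem linLiouville_zRpi : LinLiouville zRpi := by
  have hℓ : Liouville (liouvilleNumber 2) := by
    simpa using liouville_liouvilleNumber (le_refl 2)
  refine linLiouville_of_prefix (k := 2) (n := 3) (by norm_num) ?_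
  have h2 : (fun i : Fin 2 => zRpi (Fin.castLE (show 2 ≤ 3 by norm_num) i)) =
      ![(Real.pi : ℂ), ((liouvilleNumber 2 : ℝ) : ℂ) * (Real.pi : ℂ)] := by
    funext i; fin_cases i <;> simp [zRpi, mul_comm]
  rw [h2]
  exact linLiouville_of_liouville_ratio hℓ (Real.pi : ℂ)

/-- **(iii) `z_R` has NO hyper-small integer forms** (the shared-digit certificate §7; hypothesis-free). -/
theorem not_hyperLinLiouville_zR : ¬ HyperLinLiouville zR := by
  intro hH
  obtain ⟨g, hg, hlt⟩ := hH 12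
  rw [norm_zR_form] at hlt
  have hlow := form_lower_bound g hg
  have hX : (1 : ℝ) ≤ 1 + ∑ i, (|g i| : ℝ) := by
    have : (0 : ℝ) ≤ ∑ i, (|g i| : ℝ) :=
      Finset.sum_nonneg fun i _ => by exact_mod_cast abs_nonneg (g i)
    linarith
  have hmono : (1 + ∑ i, (|g i| : ℝ)) ^ 11 ≤ (1 + ∑ i, (|g i| : ℝ)) ^ 12 :=
    pow_le_pow_right₀ hX (by norm_num)
  have := Real.exp_le_exp.mpr (neg_le_neg hmono)
  linarith

/-- **(iii^π) `z_R^π` has NO hyper-small integer forms** (`|π·form| ≥ |form|`; hypothesis-free). -/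
theorem not_hyperLinLiouville_zRpi : ¬ HyperLinLiouville zRpi := by
  intro hH
  obtain ⟨g, hg, hlt⟩ := hH 12
  rw [norm_zRpi_form] at hlt
  have hlow := form_lower_bound g hg
  have hX : (1 : ℝ) ≤ 1 + ∑ i, (|g i| : ℝ) := by
    have : (0 : ℝ) ≤ ∑ i, (|g i| : ℝ) :=
      Finset.sum_nonneg fun i _ => by exact_mod_cast abs_nonneg (g i)
    linarith
  have hmono : (1 + ∑ i, (|g i| : ℝ)) ^ 11 ≤ (1 + ∑ i, (|g i| : ℝ)) ^ 12 :=
    pow_le_pow_right₀ hX (by norm_num)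
  have := Real.exp_le_exp.mpr (neg_le_neg hmono)
  have hπ : (1 : ℝ) ≤ Real.pi := by have := Real.pi_gt_three; linarith
  have habs := abs_nonneg ((g 0 : ℝ) + g 1 * liouvilleNumber 2 + g 2 * ellT)
  nlinarith

/-- **(iv) Schanuel's bound AT `z_R`** (mod `hNW` only). -/
theorem sb_zR (hNW : NWMeasure) : SB 3 zR := sb_relLiouvilleCell hNW logHyperLiouville_ellT

/-- **(iv^π) Schanuel's bound AT `z_R^π` — HYPOTHESIS-FREE.** -/
theorem sb_zRpi : SB 3 zRpi := sb_relLiouvilleCell_pi logHyperLiouville_ellT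

/-- **`z_R` lies in the scope of item 33364** — all three hypotheses, hypothesis-free. -/
theorem zR_in_scope_33364 :
    LinearIndependent ℚ zR ∧
    (∀ ω : ℕ, ∃ h : Fin 3 → ℤ, h ≠ 0 ∧ ‖∑ i, (h i : ℂ) * zR i‖ < 1 / (1 + ∑ i, (|h i| : ℝ)) ^ ω) ∧
    (¬ ∀ m : ℕ, ∃ h : Fin 3 → ℤ, h ≠ 0 ∧
      ‖∑ i, (h i : ℂ) * zR i‖ < Real.exp (-((1 + ∑ i, (|h i| : ℝ)) ^ m))) :=
  ⟨linearIndependent_zR, linLiouville_zR, not_hyperLinLiouville_zR⟩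

/-- **`z_R^π` lies in the scope of item 33364** — all three hypotheses, hypothesis-free. -/
theorem zRpi_in_scope_33364 :
    LinearIndependent ℚ zRpi ∧
    (∀ ω : ℕ, ∃ h : Fin 3 → ℤ, h ≠ 0 ∧ ‖∑ i, (h i : ℂ) * zRpi i‖ < 1 / (1 + ∑ i, (|h i| : ℝ)) ^ ω) ∧
    (¬ ∀ m : ℕ, ∃ h : Fin 3 → ℤ, h ≠ 0 ∧
      ‖∑ i, (h i : ℂ) * zRpi i‖ < Real.exp (-((1 + ∑ i, (|h i| : ℝ)) ^ m))) :=
  ⟨linearIndependent_zRpi, linLiouville_zRpi, not_hyperLinLiouville_zRpi⟩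

/-- **ITEM 33364 DECIDED AT `z_R`** (mod `hNW`): scope (i)–(iii) hypothesis-free AND the conclusion. -/
theorem finiteOrderLiouvilleSchanuel_at_zR (hNW : NWMeasure) :
    LinearIndependent ℚ zR ∧ LinLiouville zR ∧ ¬ HyperLinLiouville zR ∧ SB 3 zR :=
  ⟨linearIndependent_zR, linLiouville_zR, not_hyperLinLiouville_zR, sb_zR hNW⟩

/-- **ITEM 33364 DECIDED AT `z_R^π` — HYPOTHESIS-FREE**: scope (i)–(iii) AND the conclusion. -/
theorem finiteOrderLiouvilleSchanuel_at_zRpi :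
    LinearIndependent ℚ zRpi ∧ LinLiouville zRpi ∧ ¬ HyperLinLiouville zRpi ∧ SB 3 zRpi :=
  ⟨linearIndependent_zRpi, linLiouville_zRpi, not_hyperLinLiouville_zRpi, sb_zRpi⟩

end Cells

end Summit.Schanuel.Schanuel.Theorems.RootDecomp1KRelLiouvilleCell
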